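import Mathlib

/-!
# Transfer lemma: an individualisation–refinement PATH is simulated by ONE conflict-free colouring

Technology for the `WindowBarrier` / `NoHiddenOrder` dichotomy (route `PneNP/SymmetryBudget`,
items stmt-PneNP-2145 / stmt-PneNP-14781), abstract order-theoretic core.

A *refinement operator* on the lattice of equivalence relations of a type `α` is a monotone,
deflationary (`R s ≤ s`), idempotent map `R : Setoid α → Setoid α` (colour refinement, `k`-WL,
entropy-`K` coset refinement, the orbit map of a permutation group, …). The *I/R path* of a point
sequence `v₀, v₁, …` is `P₀ = R ⊤`, `P_{j+1} = R (P_j ⊓ sep v_j)` (individualise `v_j`, refine).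
A colouring `c : α → ℕ` is *conflict-free* for the path up to time `t` if it vanishes off
`{v_j : j < t}`, is non-zero on it, and `c v_j ≠ c v_i` whenever `j < i < t`, `v_j ≠ v_i` and
`v_i` lies in the `P_j`-class of `v_j`.

* `Refinement.transfer`: for a conflict-free colouring, `R (ker c) ≤ P_t` — refining the colouring
  alone reaches (at least) the end of the path. In particular a discretising path is simulated by a
  single colouring.
* `Refinement.exists_conflictFree`: along an injective point sequence a conflict-free colouring exists
  with `c v_j ≤ #{i ∈ (j,t) : v_i ∈ P_j-class of v_j} + 1` (reverse greedy), hence `c v_j ≤ |P_j-class of v_j|`.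

The entropy accounting (`n! ≤ 2^{n+t}·(∏_j |class_j|)²·|classStab c|`) and the permutation-group
corollary live in the companion file `…EntropyGameTransferEntropy.lean`.
-/

-- `Summit.PneNP.PneNP.…` duplicates `PneNP` BY DESIGN (single-problem summit, D-0017).
set_option linter.dupNamespace false

namespace Summit.PneNP.PneNP.Theorems.CosetGame

/-! ### Refinement operators and I/R paths -/

variable {α : Type*}

/-- The equivalence relation with classes `{v}` and `{x | x ≠ v}` (when non-empty): individualising `v`. -/
def sepSetoid (v : α) : Setoid α where
  r x y := (x = v ↔ y = v)
  iseqv := ⟨fun _ => Iff.rfl, fun h => h.symm, fun h₁ h₂ => h₁.trans h₂⟩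

/-- Unfolding `sepSetoid`. -/
theorem sepSetoid_apply (v x y : α) : sepSetoid v x y ↔ (x = v ↔ y = v) := Iff.rfl

/-- A **refinement operator** on equivalence relations: deflationary, monotone, idempotent. -/
structure Refinement (α : Type*) where
  /-- the operator -/
  R : Setoid α → Setoid α
  /-- refining: `R s` is finer than `s` -/
  le_self : ∀ s, R s ≤ s
  /-- monotone -/
  mono : Monotone R
  /-- idempotent -/
  idem : ∀ s, R (R s) = R s

namespace Refinement

variable (ρ : Refinement α)

/-- The **individualisation–refinement path** of the point sequence `v`: `P₀ = R ⊤`,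
`P_{j+1} = R (P_j ⊓ sep v_j)`. -/
def path (v : ℕ → α) : ℕ → Setoid α
  | 0 => ρ.R ⊤
  | j + 1 => ρ.R (path v j ⊓ sepSetoid (v j))

/-- Stage `0` of the path is `R ⊤`. -/
theorem path_zero (v : ℕ → α) : ρ.path v 0 = ρ.R ⊤ := rfl

/-- Stage `j+1` of the path: individualise `v_j`, refine. -/
theorem path_succ (v : ℕ → α) (j : ℕ) :
    ρ.path v (j + 1) = ρ.R (ρ.path v j ⊓ sepSetoid (v j)) := rfl

/-- The path is decreasing: `P_{j+1} ≤ P_j`. -/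
theorem path_succ_le (v : ℕ → α) (j : ℕ) : ρ.path v (j + 1) ≤ ρ.path v j :=
  (ρ.le_self _).trans inf_le_left

/-- `P_{j+1}` separates `v_j`. -/
theorem path_succ_le_sep (v : ℕ → α) (j : ℕ) : ρ.path v (j + 1) ≤ sepSetoid (v j) :=
  (ρ.le_self _).trans inf_le_right

/-- The path is antitone in the stage. -/
theorem path_antitone (v : ℕ → α) : Antitone (ρ.path v) :=
  antitone_nat_of_succ_le (ρ.path_succ_le v)

/-- Once individualised, `v_i` is a singleton class for ever: `P_j v_i x → x = v_i` for `i < j`. -/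
theorem eq_of_path_rel {v : ℕ → α} {i j : ℕ} (hij : i < j) {x : α} (h : ρ.path v j (v i) x) :
    x = v i := by
  have h' : sepSetoid (v i) (v i) x := (ρ.path_antitone v hij).trans (ρ.path_succ_le_sep v i) h
  exact (h'.1 rfl)

/-- The stages of the path are `R`-closed. -/
theorem R_path (v : ℕ → α) (j : ℕ) : ρ.R (ρ.path v j) = ρ.path v j := by
  cases j with
  | zero => exact ρ.idem ⊤
  | succ j => exact ρ.idem _

/-! ### Conflict-free colourings and the transfer lemma -/

/-- A colouring `c` is **conflict-free** for the path of `v` up to time `t`: zero off the individualised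
points, non-zero on them, and an earlier point `v_j` never shares its colour with a later, different
point `v_i` of its own `P_j`-class. -/
def ConflictFree (v : ℕ → α) (t : ℕ) (c : α → ℕ) : Prop :=
  (∀ x, (∀ j < t, x ≠ v j) → c x = 0) ∧ (∀ j < t, c (v j) ≠ 0) ∧
    ∀ j i, j < i → i < t → v j ≠ v i → ρ.path v j (v j) (v i) → c (v j) ≠ c (v i)

namespace ConflictFree

variable {ρ} {v : ℕ → α} {t : ℕ} {c : α → ℕ}

/-- A conflict-free colouring vanishes off the path points. -/
theorem zero_off (h : ρ.ConflictFree v t c) : ∀ x, (∀ j < t, x ≠ v j) → c x = 0 := h.1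

/-- A conflict-free colouring is non-zero on the path points. -/
theorem ne_zero (h : ρ.ConflictFree v t c) : ∀ j < t, c (v j) ≠ 0 := h.2.1

/-- A conflict-free colouring has no conflict inside a class. -/
theorem free (h : ρ.ConflictFree v t c) :
    ∀ j i, j < i → i < t → v j ≠ v i → ρ.path v j (v j) (v i) → c (v j) ≠ c (v i) := h.2.2

end ConflictFree

/-- **Transfer lemma.** Refining a conflict-free colouring reaches the end of the path:
`R (ker c) ≤ P_t`. Proof: by induction `R (ker c) ≤ P_j`; at stage `j` the only point of the
`P_j`-class of `v_j` with colour `c v_j` is `v_j` itself (earlier points are singletons, later ones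
have other colours, the rest has colour `0`), so `R (ker c)` separates `v_j`, and being `R`-closed it
lies below `R (P_j ⊓ sep v_j) = P_{j+1}`. -/
theorem transfer {v : ℕ → α} {t : ℕ} {c : α → ℕ} (hc : ρ.ConflictFree v t c) :
    ρ.R (Setoid.ker c) ≤ ρ.path v t := by
  set Q := ρ.R (Setoid.ker c) with hQ
  have hQc : Q ≤ Setoid.ker c := ρ.le_self _
  have hRQ : ρ.R Q = Q := ρ.idem _
  suffices h : ∀ j, j ≤ t → Q ≤ ρ.path v j from h t le_rfl
  intro j
  induction j with
  | zero => exact fun _ => ρ.mono le_top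
  | succ j ih =>
    intro hjt
    have hj : j < t := Nat.lt_of_succ_le hjt
    have IH : Q ≤ ρ.path v j := ih hj.le
    -- the key claim: `Q` separates `v j`
    have key : ∀ x, Q x (v j) → x = v j := by
      intro x hx
      by_contra hne
      have hcx : c x = c (v j) := Setoid.ker_def.1 (hQc hx)
      have hx0 : c x ≠ 0 := by rw [hcx]; exact hc.ne_zero j hj
      obtain ⟨i, hi, rfl⟩ : ∃ i, i < t ∧ x = v i := by
        by_contra hno
        push Not at hno
        exact hx0 (hc.zero_off x fun i hi h => hno i hi h)
      rcases lt_trichotomy i j with hlt | heq | hgt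
      · exact hne (ρ.eq_of_path_rel hlt (IH hx)).symm
      · exact hne (by rw [heq])
      · exact hc.free j i hgt hi (Ne.symm hne) ((ρ.path v j).symm' (IH hx)) hcx.symm
    have hle : Q ≤ ρ.path v j ⊓ sepSetoid (v j) := by
      refine le_inf IH ?_
      intro x y hxy
      constructor
      · intro hx
        subst hx
        exact key y (Q.symm' hxy)
      · intro hy
        subst hy
        exact key x hxy
    calc Q = ρ.R Q := hRQ.symm
      _ ≤ ρ.R (ρ.path v j ⊓ sepSetoid (v j)) := ρ.mono hle
      _ = ρ.path v (j + 1) := rfl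

/-- A discretising path is simulated by one colouring. -/
theorem R_ker_eq_bot_of_conflictFree {v : ℕ → α} {t : ℕ} {c : α → ℕ} (hc : ρ.ConflictFree v t c)
    (ht : ρ.path v t = ⊥) : ρ.R (Setoid.ker c) = ⊥ :=
  le_bot_iff.1 (ht ▸ ρ.transfer hc)


/-! ### Existence: the reverse greedy colouring -/

section Greedy

open scoped Classical

/-- A finite set of naturals misses some positive natural. -/
theorem exists_pos_notMem (S : Finset ℕ) : ∃ m, 0 < m ∧ m ∉ S :=
  ⟨S.sup id + 1, Nat.succ_pos _, fun h => by
    have : S.sup id + 1 ≤ S.sup id := Finset.le_sup (f := id) h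
    omega⟩

variable (v : ℕ → α) (t : ℕ)

/-- The later indices `i ∈ (j, t)` whose point is a different member of the `P_j`-class of `v_j`. -/
noncomputable def conflicts (j : ℕ) : Finset ℕ :=
  (Finset.Ioo j t).filter fun i => v j ≠ v i ∧ ρ.path v j (v j) (v i)

/-- Membership in `conflicts`. -/
theorem mem_conflicts {j i : ℕ} :
    i ∈ ρ.conflicts v t j ↔ (j < i ∧ i < t) ∧ v j ≠ v i ∧ ρ.path v j (v j) (v i) := by
  unfold conflicts
  rw [Finset.mem_filter, Finset.mem_Ioo]

/-- **Reverse greedy colouring of the indices**: `greedy j` is the least positive colour not used by a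
later conflicting index (`0` for `j ≥ t`). -/
noncomputable def greedy (j : ℕ) : ℕ :=
  if j < t then
    Nat.find (exists_pos_notMem (((ρ.conflicts v t j).attach).image fun i => greedy i.1))
  else 0
termination_by t - j
decreasing_by
  all_goals
    have hi := (ρ.mem_conflicts v t).1 i.2
    omega

/-- Unfolding `greedy` below `t`. -/
theorem greedy_eq {j : ℕ} (hj : j < t) :
    ρ.greedy v t j =
      Nat.find (exists_pos_notMem (((ρ.conflicts v t j).attach).image fun i => ρ.greedy v t i.1)) := by
  rw [greedy, if_pos hj]

/-- `greedy j = 0` for `j ≥ t`. -/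
theorem greedy_eq_zero {j : ℕ} (hj : t ≤ j) : ρ.greedy v t j = 0 := by
  rw [greedy, if_neg (not_lt.2 hj)]

/-- Greedy colours below `t` are positive. -/
theorem greedy_pos {j : ℕ} (hj : j < t) : 0 < ρ.greedy v t j := by
  rw [ρ.greedy_eq v t hj]
  exact (Nat.find_spec (exists_pos_notMem _)).1

/-- The greedy colour of `j` differs from the colour of every later conflicting index. -/
theorem greedy_ne_of_mem_conflicts {j i : ℕ} (hi : i ∈ ρ.conflicts v t j) :
    ρ.greedy v t j ≠ ρ.greedy v t i := by
  have hj : j < t := by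
    have h := (ρ.mem_conflicts v t).1 hi
    omega
  intro he
  have hspec := (Nat.find_spec (exists_pos_notMem
    (((ρ.conflicts v t j).attach).image fun i => ρ.greedy v t i.1))).2
  rw [← ρ.greedy_eq v t hj] at hspec
  refine hspec (Finset.mem_image.2 ⟨⟨i, hi⟩, Finset.mem_attach _ _, ?_⟩)
  exact he.symm

/-- The greedy colour of `j` is at most `#conflicts(j) + 1`. -/
theorem greedy_le_card_conflicts_succ {j : ℕ} (hj : j < t) :
    ρ.greedy v t j ≤ (ρ.conflicts v t j).card + 1 := by
  set S : Finset ℕ := ((ρ.conflicts v t j).attach).image fun i => ρ.greedy v t i.1 with hS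
  have hcard : S.card ≤ (ρ.conflicts v t j).card := by
    refine (Finset.card_image_le).trans ?_
    rw [Finset.card_attach]
  have hfind : ρ.greedy v t j = Nat.find (exists_pos_notMem S) := ρ.greedy_eq v t hj
  by_contra hlt
  push Not at hlt
  -- every `m' ∈ [1, #S + 1]` is `< greedy j`, hence lies in `S` by minimality
  have hsub : Finset.Icc 1 (S.card + 1) ⊆ S := by
    intro m hm
    rw [Finset.mem_Icc] at hm
    have hm' : m < Nat.find (exists_pos_notMem S) := by rw [← hfind]; omega
    have hmin := Nat.find_min (exists_pos_notMem S) hm'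
    by_contra hnot
    exact hmin ⟨by omega, hnot⟩
  have := Finset.card_le_card hsub
  rw [Nat.card_Icc] at this
  omega

/-- **The reverse greedy colouring of the points** `{v_j : j < t}` (zero elsewhere). -/
noncomputable def greedyColouring (x : α) : ℕ :=
  if h : ∃ j, j < t ∧ v j = x then ρ.greedy v t (Nat.find h) else 0

variable {v t}

/-- On a path point the greedy colouring is the greedy colour of its (unique) index. -/
theorem greedyColouring_apply (hinj : ∀ i j, i < t → j < t → v i = v j → i = j) {j : ℕ} (hj : j < t) :
    ρ.greedyColouring v t (v j) = ρ.greedy v t j := by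
  unfold greedyColouring
  have h : ∃ j', j' < t ∧ v j' = v j := ⟨j, hj, rfl⟩
  rw [dif_pos h]
  have hspec := Nat.find_spec h
  rw [hinj _ _ hspec.1 hj hspec.2]

/-- Off the path points the greedy colouring vanishes. -/
theorem greedyColouring_eq_zero {x : α} (hx : ∀ j < t, x ≠ v j) : ρ.greedyColouring v t x = 0 := by
  unfold greedyColouring
  rw [dif_neg]
  rintro ⟨j, hj, rfl⟩
  exact hx j hj rfl

/-- **Existence.** Along an injective point sequence the reverse greedy colouring is conflict-free. -/
theorem conflictFree_greedyColouring (hinj : ∀ i j, i < t → j < t → v i = v j → i = j) :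
    ρ.ConflictFree v t (ρ.greedyColouring v t) := by
  refine ⟨fun x hx => ρ.greedyColouring_eq_zero hx, fun j hj => ?_, fun j i hji hi hne hrel => ?_⟩
  · rw [ρ.greedyColouring_apply hinj hj]
    exact (ρ.greedy_pos v t hj).ne'
  · rw [ρ.greedyColouring_apply hinj (hji.trans hi), ρ.greedyColouring_apply hinj hi]
    exact ρ.greedy_ne_of_mem_conflicts v t ((ρ.mem_conflicts v t).2 ⟨⟨hji, hi⟩, hne, hrel⟩)

/-- **Colour bound.** The greedy colour of `v_j` is at most the size of the `P_j`-class of `v_j`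
(the conflicting later points are distinct members of that class other than `v_j`). -/
theorem greedyColouring_le_card_class [Fintype α]
    (hinj : ∀ i j, i < t → j < t → v i = v j → i = j) {j : ℕ} (hj : j < t) :
    ρ.greedyColouring v t (v j) ≤ (Finset.univ.filter fun x => ρ.path v j (v j) x).card := by
  rw [ρ.greedyColouring_apply hinj hj]
  refine (ρ.greedy_le_card_conflicts_succ v t hj).trans ?_
  -- `i ↦ v i` injects the conflicts into the class minus `v j`
  have hmap : ((ρ.conflicts v t j).image v) ⊆ (Finset.univ.filter fun x => ρ.path v j (v j) x).erase (v j) := by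
    intro x hx
    obtain ⟨i, hi, rfl⟩ := Finset.mem_image.1 hx
    have h := (ρ.mem_conflicts v t).1 hi
    rw [Finset.mem_erase, Finset.mem_filter]
    exact ⟨h.2.1.symm, Finset.mem_univ _, h.2.2⟩
  have hinj' : Set.InjOn v (ρ.conflicts v t j : Set ℕ) := by
    intro i hi i' hi' h
    have h1 := (ρ.mem_conflicts v t).1 (Finset.mem_coe.1 hi)
    have h2 := (ρ.mem_conflicts v t).1 (Finset.mem_coe.1 hi')
    exact hinj _ _ h1.1.2 h2.1.2 h
  have hc := Finset.card_le_card hmap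
  rw [Finset.card_image_of_injOn hinj'] at hc
  have hmem : v j ∈ Finset.univ.filter fun x => ρ.path v j (v j) x :=
    Finset.mem_filter.2 ⟨Finset.mem_univ _, (ρ.path v j).refl' _⟩
  rw [Finset.card_erase_of_mem hmem] at hc
  have hpos : 0 < (Finset.univ.filter fun x => ρ.path v j (v j) x).card := Finset.card_pos.2 ⟨_, hmem⟩
  omega

end Greedy

end Refinement

end Summit.PneNP.PneNP.Theorems.CosetGame
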